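import Summits.QuantumFields.YangMills.Theorems.SwapVirialDeficitSwapRingOddSectorMeanDeficit
import Summits.QuantumFields.YangMills.Theorems.SwapVirialDeficitSwapRingSectorPairing
import Summits.QuantumFields.YangMills.Theses.SwapVirialDeficit
import HarnessLib

/-!
# ⟨24197⟩ `SwapGluedStiffness` from the WINDOW STIFFNESS OF TWO SECTORS (`000` and `001`), by name

A sector-level reduction of the crux, parallel to fcl-p3 g46's ✓`swapGluedStiffness_of_virialWindow` (virial functionals) and fcl-p3 g43's
✓`swapGluedStiffness_of_principal_and_minusClass` (sharp small-ball laws): the crux's quantity is `β(log Z^S)′ = 12βL⁴ − β·Σ_zE_z/Σ_zZ_z`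
(✓`mul_deriv_log_twistTrace_eq`) over the EIGHT seam sectors; of these, `110 ∕ 111` are the slice-flip images of `000 ∕ 001`
(✓`integral_comp_swapDeficit_sliceFlip`) and the four ODD sectors are window-stiff for free (✓`oddSector_virialWindow`, explicit gap `(1248L³)⁻²`).  So:

* §1 `even_sector_cases`, `integral_swapDeficit_mul_exp_sliceFlip` (`E_{z+(1,1,0)} = E_z`);
* §2 ★★ `sector_stiffness_all` — `κ·Z_z ≤ b·E_z` for `z = 000, 001` and `b ≥ κ(1248L³)²` ⟹ the same for all eight `z`; ★★★
  `swapGluedStiffness_of_twoSectorStiffness (hTS) : Theses.SwapVirialDeficit.SwapGluedStiffness` — THE CRUX BY NAME from (TS): on a window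
  `L₀ ≤ L ≤ β^a`, `β ≥ β₀`, the principal sector `000` AND the minus sector `001` satisfy `(9L⁴ − 3/2 + c)·Z_z(β) ≤ β·E_z(β)`
  (`β⟨F^S_z⟩_β ≥ 9L⁴ − 3/2 + c`); output constants `a' = min a (1/20)`, same `c`, `β₀' = max β₀ (max 1 ((10+c)·1248²)²)`, same `L₀`.
  By ✓`virial_ring`, (TS) for each of the two sectors is exactly its per-sector virial window row `½K_L⟪W⟫_{z,β} − βK_L⟪R⟫_{z,β} ≤ (1/2 − c)Z_z(β)`,
  whose followers' ∕ large-field shares are discharged in ✓`…VirialFollowersShare` ∕ ✓`…SwapRingLargeFieldShare` (principal sector).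

HONEST LABEL: a REDUCTION (proved); (TS) is crux-level and OPEN — for `000` it is the leaders' valley term + remainder, for `001` the minus sector's own
window stiffness (fixed-`L`: exponent `9L⁴ − 1/2`, room `1 − c`); ⟨24197⟩ ∕ ⟨24194⟩ ∕ ⟨24497⟩ OPEN; own crux ⟨22884⟩ OPEN (blocked-on ⟨19935⟩); no crux, rung of
record or summit is proved; the Yang–Mills mass gap is NOT proved; no summit is proved by a line.  THEOREMS ONLY (hypothesis inline; 0 `def`, 0 `sorry`),
standard axioms.  Width seat ym-line-sfw-p2-w2 g57 (cell ym-idea-1, free hands), `--supports stmt-QuantumFields-24197`.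
References: [cite: tHooft1979]; [cite: Luscher1983, §2]; [folklore].
-/

set_option autoImplicit false

noncomputable section

open MeasureTheory Set Filter
open scoped BigOperators
open Literature.MathematicalPhysics.QuantumFieldTheory hiding SU2
open Literature.MathematicalPhysics.QuantumLattice

namespace Summit.QuantumFields.YangMills.Theorems.SwapVirialDeficit.SwapRing

open Summit.QuantumFields.YangMills.Theorems.FemtoTransferGap
open Summit.QuantumFields.YangMills.Theorems.FemtoTransferGap.TT
open Summit.QuantumFields.YangMills.Theorems.VirialFluxGap.RingDeficit

variable {L : ℕ} [NeZero L]

/-! ## §1 Sector bookkeeping: the even sectors are the pairs of `000` and `001` -/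

omit [NeZero L] in
/-- An even label (`z 0 = z 1`) is one of `000, 001, 110, 111`, written as the slice-flip images of `000` and `001`. [folklore] -/
theorem even_sector_cases (z : Fin 3 → Bool) (h : z 0 = z 1) :
    z = (fun _ => false) ∨ z = (fun k => decide (k = 2)) ∨
      z = (fun k => Bool.xor ((fun _ : Fin 3 => false) k) (decide (k ≠ 2))) ∨ z = (fun k => Bool.xor ((fun k : Fin 3 => decide (k = 2)) k) (decide (k ≠ 2))) := by
  cases h0 : z 0 <;> cases h2 : z 2
  · left; funext k; fin_cases k <;> simp_all
  · right; left; funext k; fin_cases k <;> simp_all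
  · right; right; left; funext k; fin_cases k <;> simp_all
  · right; right; right; funext k; fin_cases k <;> simp_all

/-- Paired sector mean deficits: `E_{z+(1,1,0)}(b) = E_z(b)`. [cite: tHooft1979] -/
theorem integral_swapDeficit_mul_exp_sliceFlip (z : Fin 3 → Bool) (b : ℝ) :
    ∫ P, swapRingDeficit L (fun k => Bool.xor (z k) (decide (k ≠ 2))) P *
        Real.exp (-(b * swapRingDeficit L (fun k => Bool.xor (z k) (decide (k ≠ 2))) P)) ∂(ringMeasure L) =
      ∫ P, swapRingDeficit L z P * Real.exp (-(b * swapRingDeficit L z P)) ∂(ringMeasure L) :=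
  integral_comp_swapDeficit_sliceFlip z (fun x => x * Real.exp (-(b * x))) (measurable_id.mul (measurable_const.mul measurable_id).neg.exp)

/-! ## §2 Per-sector stiffness on the window implies the crux -/

/-- ★★ **Every sector is stiff on the window if `000` and `001` are**: for `κ ≥ 0` and `b ≥ κ·(1248L³)²`, if `κ·Z_z(b) ≤ b·E_z(b)` holds for `z = 000`
and `z = 001`, then it holds for ALL eight `z` (pairing ✓`integral_comp_swapDeficit_sliceFlip` for `110, 111`; ✓`oddSector_virialWindow` for the four odd
labels). [cite: tHooft1979] [cite: Luscher1983, §2] -/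
theorem sector_stiffness_all {κ b : ℝ} (hκ : 0 ≤ κ) (hb : κ * (1248 * (L : ℝ) ^ 3) ^ 2 ≤ b)
    (h000 : κ * ∫ P, Real.exp (-(b * swapRingDeficit L (fun _ => false) P)) ∂(ringMeasure L) ≤
      b * ∫ P, swapRingDeficit L (fun _ => false) P * Real.exp (-(b * swapRingDeficit L (fun _ => false) P)) ∂(ringMeasure L))
    (h001 : κ * ∫ P, Real.exp (-(b * swapRingDeficit L (fun k => decide (k = 2)) P)) ∂(ringMeasure L) ≤
      b * ∫ P, swapRingDeficit L (fun k => decide (k = 2)) P * Real.exp (-(b * swapRingDeficit L (fun k => decide (k = 2)) P)) ∂(ringMeasure L))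
    (z : Fin 3 → Bool) :
    κ * ∫ P, Real.exp (-(b * swapRingDeficit L z P)) ∂(ringMeasure L) ≤
      b * ∫ P, swapRingDeficit L z P * Real.exp (-(b * swapRingDeficit L z P)) ∂(ringMeasure L) := by
  by_cases hz : z 0 = z 1
  · rcases even_sector_cases z hz with h | h | h | h
    · rw [h]; exact h000
    · rw [h]; exact h001
    · rw [h, integral_exp_swapDeficit_sliceFlip, integral_swapDeficit_mul_exp_sliceFlip]; exact h000
    · rw [h, integral_exp_swapDeficit_sliceFlip, integral_swapDeficit_mul_exp_sliceFlip]; exact h001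
  · have h := oddSector_virialWindow (L := L) z hz hκ hb
    linarith

/-- ★★★ **⟨24197⟩ `SwapGluedStiffness` FROM TWO-SECTOR WINDOW STIFFNESS, BY NAME.**  Hypothesis (TS), stated inline: there are `a > 0`, `c > 0`, `β₀`, `L₀`
such that for `β ≥ β₀` and `L₀ ≤ L ≤ β^a`, BOTH the principal sector `z = 000` and the minus sector `z = 001` are window-stiff:
`(9L⁴ − 3/2 + c)·Z_z(β) ≤ β·E_z(β)`, `Z_z(β) = ∫ e^{−βF^S_z} dμ_L`, `E_z(β) = ∫ F^S_z e^{−βF^S_z} dμ_L` (Gibbs-mean words: `β⟨F^S_z⟩_β ≥ 9L⁴ − 3/2 + c`).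
Then the crux holds with `a' = min a (1/20)`, the same `c`, `β₀' = max β₀ (max 1 ((10 + c)·1248²)²)`, `L₀`: the sectors `110, 111` follow by the slice-flip
pairing, the four odd sectors by the uniform explicit gap (`β ≥ (9L⁴ − 3/2 + c)(1248L³)²` is automatic on the window `L ≤ β^{1/20}`), and
`β(log Z^S)′(β) = 12βL⁴ − β·Σ_zE_z/Σ_zZ_z` (✓`mul_deriv_log_twistTrace_eq`).  By ✓`virial_ring` the hypothesis for each of the two sectors is EXACTLY the
per-sector virial window row `½K_L⟪W⟫_{z,β} − βK_L⟪R⟫_{z,β} ≤ (1/2 − c)·Z_z(β)`.  (TS) is OPEN (crux-level); this is a reduction. [cite: tHooft1979] [cite: Luscher1983, §2] -/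
theorem swapGluedStiffness_of_twoSectorStiffness
    (hTS : ∃ a : ℝ, 0 < a ∧ ∃ c : ℝ, 0 < c ∧ ∃ β₀ : ℝ, ∃ L₀ : ℕ, ∀ β : ℝ, β₀ ≤ β → ∀ (L : ℕ) [NeZero L], L₀ ≤ L → (L : ℝ) ≤ β ^ a →
      (9 * (L : ℝ) ^ 4 - 3 / 2 + c) * ∫ P, Real.exp (-(β * swapRingDeficit L (fun _ => false) P)) ∂(ringMeasure L) ≤
          β * ∫ P, swapRingDeficit L (fun _ => false) P * Real.exp (-(β * swapRingDeficit L (fun _ => false) P)) ∂(ringMeasure L) ∧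
        (9 * (L : ℝ) ^ 4 - 3 / 2 + c) * ∫ P, Real.exp (-(β * swapRingDeficit L (fun k => decide (k = 2)) P)) ∂(ringMeasure L) ≤
          β * ∫ P, swapRingDeficit L (fun k => decide (k = 2)) P * Real.exp (-(β * swapRingDeficit L (fun k => decide (k = 2)) P)) ∂(ringMeasure L)) :
    Summit.QuantumFields.YangMills.Theses.SwapVirialDeficit.SwapGluedStiffness := by
  obtain ⟨a, ha, c, hc, β₀, L₀, hTS⟩ := hTS
  refine ⟨min a (1 / 20), lt_min ha (by norm_num), c, hc, max β₀ (max 1 (((10 + c) * 1248 ^ 2) ^ 2)), L₀, fun β hβ L _ hL hLβ => ?_⟩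
  have hβ₀ : β₀ ≤ β := (le_max_left _ _).trans hβ
  have hβ1 : (1 : ℝ) ≤ β := (le_max_left _ _).trans ((le_max_right _ _).trans hβ)
  have hβbig : ((10 + c) * 1248 ^ 2) ^ 2 ≤ β := (le_max_right _ _).trans ((le_max_right _ _).trans hβ)
  have hβpos : 0 < β := lt_of_lt_of_le one_pos hβ1
  have hL1 : (1 : ℝ) ≤ L := by exact_mod_cast NeZero.one_le
  -- the window `L ≤ β^{min a 1/20}` lies inside both `L ≤ β^a` and `L ≤ β^{1/20}`
  have hLa : (L : ℝ) ≤ β ^ a := hLβ.trans (Real.rpow_le_rpow_of_exponent_le hβ1 (min_le_left _ _))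
  have hL20 : (L : ℝ) ≤ β ^ (1 / 20 : ℝ) := hLβ.trans (Real.rpow_le_rpow_of_exponent_le hβ1 (min_le_right _ _))
  obtain ⟨h000, h001⟩ := hTS β hβ₀ L hL hLa
  -- the stiffness constant and the odd-sector threshold on the window
  have hκ : 0 ≤ 9 * (L : ℝ) ^ 4 - 3 / 2 + c := by nlinarith [one_le_pow₀ (n := 4) hL1]
  have hL10 : (L : ℝ) ^ 10 ≤ Real.sqrt β := by
    have h1 : (L : ℝ) ^ 10 ≤ (β ^ (1 / 20 : ℝ)) ^ 10 := pow_le_pow_left₀ (by positivity) hL20 10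
    have h2 : (β ^ (1 / 20 : ℝ)) ^ 10 = Real.sqrt β := by
      rw [← Real.rpow_natCast, ← Real.rpow_mul hβpos.le, Real.sqrt_eq_rpow]; norm_num
    rw [← h2]; exact h1
  have hsqrt : Real.sqrt β * Real.sqrt β = β := Real.mul_self_sqrt hβpos.le
  have hsq1 : (10 + c) * 1248 ^ 2 ≤ Real.sqrt β := by
    rw [← Real.sqrt_sq (by positivity : (0:ℝ) ≤ (10 + c) * 1248 ^ 2)]
    exact Real.sqrt_le_sqrt hβbig
  have hb : (9 * (L : ℝ) ^ 4 - 3 / 2 + c) * (1248 * (L : ℝ) ^ 3) ^ 2 ≤ β := by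
    have e1 : 9 * (L : ℝ) ^ 4 - 3 / 2 + c ≤ (10 + c) * (L : ℝ) ^ 4 := by nlinarith [one_le_pow₀ (n := 4) hL1, hc]
    have e2 : (9 * (L : ℝ) ^ 4 - 3 / 2 + c) * (1248 * (L : ℝ) ^ 3) ^ 2 ≤ ((10 + c) * 1248 ^ 2) * (L : ℝ) ^ 10 :=
      calc (9 * (L : ℝ) ^ 4 - 3 / 2 + c) * (1248 * (L : ℝ) ^ 3) ^ 2 ≤ (10 + c) * (L : ℝ) ^ 4 * (1248 * (L : ℝ) ^ 3) ^ 2 :=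
            mul_le_mul_of_nonneg_right e1 (by positivity)
        _ = ((10 + c) * 1248 ^ 2) * (L : ℝ) ^ 10 := by ring
    have e3 : ((10 + c) * 1248 ^ 2) * (L : ℝ) ^ 10 ≤ Real.sqrt β * Real.sqrt β := mul_le_mul hsq1 hL10 (by positivity) (Real.sqrt_nonneg _)
    rw [hsqrt] at e3
    exact e2.trans e3
  -- every sector is stiff
  have hall := sector_stiffness_all (L := L) hκ hb h000 h001
  -- the log-derivative
  rw [mul_deriv_log_twistTrace_eq]
  have hS := sum_integral_exp_swapDeficit_pos (L := L) β
  have hsum : (9 * (L : ℝ) ^ 4 - 3 / 2 + c) * ∑ z : Fin 3 → Bool, ∫ P, Real.exp (-(β * swapRingDeficit L z P)) ∂(ringMeasure L) ≤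
      β * ∑ z : Fin 3 → Bool, ∫ P, swapRingDeficit L z P * Real.exp (-(β * swapRingDeficit L z P)) ∂(ringMeasure L) := by
    rw [Finset.mul_sum, Finset.mul_sum]
    exact Finset.sum_le_sum fun z _ => hall z
  have hdiv : 9 * (L : ℝ) ^ 4 - 3 / 2 + c ≤ β * ((∑ z : Fin 3 → Bool, ∫ P, swapRingDeficit L z P * Real.exp (-(β * swapRingDeficit L z P)) ∂(ringMeasure L)) /
      ∑ z : Fin 3 → Bool, ∫ P, Real.exp (-(β * swapRingDeficit L z P)) ∂(ringMeasure L)) := by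
    rw [mul_div_assoc', le_div_iff₀ hS]; exact hsum
  linarith

end Summit.QuantumFields.YangMills.Theorems.SwapVirialDeficit.SwapRing

end
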